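import Summits.FinalStateConjecture.FinalStateConjecture.Theses.BondiDrainDispersal
import Summits.FinalStateConjecture.FinalStateConjecture.Theorems.BondiDrainDispersalHorizonlessMustDrainNormalForm
import Literature.Geometry.Lorentzian.TrappedSurface
import HarnessLib

/-!
# Crux `HorizonlessMustDrain` (stmt-FinalStateConjecture-9976) — cross-route consistency with
# `NoNullFinalMomentum.TrappedImpliesMassive`: the two Bondi cruxes jointly predict Penrose's
# "a closed trapped surface is hidden behind an event horizon"

Two open cruxes of two routes of the final-state summit speak about the same quantity, the final
Bondi rest mass `CauchyDevelopment.HasVanishingFinalBondiMass` (definition N1, `CutBondiMass.lean`),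
with opposite signs:

* `BondiDrainDispersal.HorizonlessMustDrain` (stmt-FinalStateConjecture-9976, this file's item): a
  censored MGHD (complete `𝓘⁺`, sojourn form) with NO event horizon (typed ray-theoretic clause)
  has VANISHING final Bondi mass;
* `NoNullFinalMomentum.TrappedImpliesMassive` (stmt-FinalStateConjecture-11720): a censored MGHD
  containing a closed trapped surface (a smoothly parametrised `2`-sphere `f : S² → M` to the causal
  future of the data with `θ_L < 0`, `θ_L̲ < 0`, `LorentzianMetric.IsTrappedSurface`) has
  NON-vanishing final Bondi mass.

Put together (pure logic, `trappedSurface_hasEventHorizon_of_cruxes`): **for every admissible datum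
and every censored MGHD, a closed trapped surface to the future of the data forces an event horizon**
— some event is invisible from every future-complete normalised null ray from the data hypersurface,
i.e. the intrinsic black-hole region `DataEmbedding.blackHoleRegion` is nonempty
(`trappedSurface_blackHoleRegion_nonempty_of_cruxes`).  This joint prediction is the sojourn /
ray-theoretic form of a PRINTED theorem — Hawking–Ellis 1973, Prop. 9.2.1 (in a future asymptotically
predictable spacetime developing from a partial Cauchy surface and satisfying the null convergence
condition, a closed trapped surface lies in the black-hole region `M ∖ J⁻(𝓘⁺)`; Wald 1984,
Prop. 12.2.2) — so the two cruxes are mutually CONSISTENT exactly to the extent that Penrose's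
theorem holds in the summit's typing, and a censored, horizonless vacuum MGHD containing a closed
trapped surface in `J⁺(ι X)` would refute at least one of them (`not_both_cruxes_of_trappedHorizonless`,
the disprover's cheapest joint target: it needs no Bondi mass at all).

Everything is proved; no definition and no named fact is introduced; the statement of
`TrappedImpliesMassive` is reproduced VERBATIM as a hypothesis (its route file is deliberately not
imported, D-0016), so a seat holding both items can `exact` these theorems.
Helper file for the crux (`--supports stmt-FinalStateConjecture-9976`); it proves no route item.
References: Penrose 1965; Hawking–Ellis 1973, §9.2, Prop. 9.2.1 (p. 311); Wald 1984, §12.2,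
Prop. 12.2.2 (p. 310).
-/

noncomputable section

open Set Literature.Geometry.Lorentzian
open scoped Manifold ContDiff

namespace Summit.FinalStateConjecture.FinalStateConjecture.Theorems.BondiDrainDispersalHorizonlessMustDrain

-- D-0017: single-problem summit, `Summit.<S>.<S>.…` by design.
set_option linter.dupNamespace false

open Summit.FinalStateConjecture.FinalStateConjecture.Theses.BondiDrainDispersal (HorizonlessMustDrain)

/-- **Registered glue stub `stub_trappedHasHorizon_of_cruxes` — THE TWO BONDI CRUXES PREDICT PENROSE'S THEOREM.**
Assume `HorizonlessMustDrain` (this route's crux, by name) and route NoNullFinalMomentum's crux `TrappedImpliesMassive`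
(stmt-FinalStateConjecture-11720, reproduced verbatim as the second hypothesis).  Then for every admissible datum `D` and every
maximal vacuum Cauchy development `𝒟` of `D` with complete future null infinity (sojourn form): if some smoothly parametrised
`2`-sphere to the causal future of the data is a closed trapped surface, `𝒟` HAS an event horizon in the typed ray-theoretic
sense — some event `q` lies outside the chronological past `I⁻(γ(dom ∩ [0,∞)))` of every future-complete normalised null ray
`γ` from the data hypersurface.  (Otherwise the first crux makes the final Bondi mass vanish and the second forbids it.)  The
conclusion is the sojourn-form reading of Hawking–Ellis 1973, Prop. 9.2.1 / Wald 1984, Prop. 12.2.2 ("a closed trapped surface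
lies in the black-hole region"). [cite: HawkingEllis1973, §9.2, Prop. 9.2.1] -/
theorem stub_trappedHasHorizon_of_cruxes : open scoped Manifold in Summit.FinalStateConjecture.FinalStateConjecture.Theses.BondiDrainDispersal.HorizonlessMustDrain → (∀ (X : Type) [TopologicalSpace X] [ChartedSpace Literature.Geometry.Lorentzian.E3 X] [IsManifold (𝓡 3) ((⊤ : ℕ∞) : WithTop ℕ∞) X] [T2Space X] [SecondCountableTopology X] [ConnectedSpace X], ∀ D ∈ Literature.Geometry.Lorentzian.admissibleVacuumData X, ∀ 𝒟 : Literature.Geometry.Lorentzian.VacuumCauchyDevelopment D, 𝒟.IsMaximal → Summit.FinalStateConjecture.HasCompleteNullInfinity 𝒟.toCauchyDevelopment → (∀ [𝒟.metric.HasLeviCivita], ∃ f : Metric.sphere (0 : Literature.Geometry.Lorentzian.E3) 1 → 𝒟.carrier, Set.range f ⊆ 𝒟.metric.causalFuture 𝒟.timeOrientation (Set.range 𝒟.embed) ∧ 𝒟.metric.IsTrappedSurface (𝓡 2) 𝒟.timeOrientation f) → ¬ 𝒟.toCauchyDevelopment.HasVanishingFinalBondiMass) → ∀ (X : Type) [TopologicalSpace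 X] [ChartedSpace Literature.Geometry.Lorentzian.E3 X] [IsManifold (𝓡 3) ((⊤ : ℕ∞) : WithTop ℕ∞) X] [T2Space X] [SecondCountableTopology X] [ConnectedSpace X], ∀ D ∈ Literature.Geometry.Lorentzian.admissibleVacuumData X, ∀ 𝒟 : Literature.Geometry.Lorentzian.VacuumCauchyDevelopment D, 𝒟.IsMaximal → Summit.FinalStateConjecture.HasCompleteNullInfinity 𝒟.toCauchyDevelopment → (∀ [𝒟.metric.HasLeviCivita], ∃ f : Metric.sphere (0 : Literature.Geometry.Lorentzian.E3) 1 → 𝒟.carrier, Set.range f ⊆ 𝒟.metric.causalFuture 𝒟.timeOrientation (Set.range 𝒟.embed) ∧ 𝒟.metric.IsTrappedSurface (𝓡 2) 𝒟.timeOrientation f) → ∀ [𝒟.metric.HasLeviCivita], ∃ q : 𝒟.carrier, ∀ (p : X) (γ : ℝ → 𝒟.carrier) (dom : Set ℝ), 𝒟.metric.IsNormalisedNullRayFrom 𝒟.timeOrientation 𝒟.embed 𝒟.normal p γ dom → ¬ BddAbove dom → q ∉ 𝒟.metric.chronologicalPast 𝒟.timeOrientation (γ '' (dom ∩ Set.Ici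 0)) := by
  intro hM hT X _ _ _ _ _ _ D hD 𝒟 hmax hscri htrap
  -- if there were no event horizon, the first crux would drain the final Bondi mass …
  by_contra hH
  -- … while the trapped surface, by the second crux, forbids exactly that
  exact hT X D hD 𝒟 hmax hscri htrap (hM X D hD 𝒟 hmax hscri hH)

/-- **The two Bondi cruxes predict Penrose's theorem** (statement form of the registered glue stub, same content):
`HorizonlessMustDrain ∧ TrappedImpliesMassive ⇒` every censored MGHD of an admissible datum containing a closed trapped
surface to the causal future of the data has an event horizon (typed clause). Hawking–Ellis 1973, Prop. 9.2.1.
[cite: HawkingEllis1973, §9.2, Prop. 9.2.1] -/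
theorem trappedSurface_hasEventHorizon_of_cruxes (hM : HorizonlessMustDrain)
    (hT : ∀ (X : Type) [TopologicalSpace X] [ChartedSpace E3 X] [IsManifold (𝓡 3) ∞ X] [T2Space X]
      [SecondCountableTopology X] [ConnectedSpace X],
      ∀ D ∈ admissibleVacuumData X, ∀ 𝒟 : VacuumCauchyDevelopment D, 𝒟.IsMaximal →
        Summit.FinalStateConjecture.HasCompleteNullInfinity 𝒟.toCauchyDevelopment →
        (∀ [𝒟.metric.HasLeviCivita], ∃ f : Metric.sphere (0 : E3) 1 → 𝒟.carrier,
          range f ⊆ 𝒟.metric.causalFuture 𝒟.timeOrientation (range 𝒟.embed) ∧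
            𝒟.metric.IsTrappedSurface (𝓡 2) 𝒟.timeOrientation f) →
        ¬ 𝒟.toCauchyDevelopment.HasVanishingFinalBondiMass)
    {X : Type} [TopologicalSpace X] [ChartedSpace E3 X] [IsManifold (𝓡 3) ∞ X] [T2Space X]
    [SecondCountableTopology X] [ConnectedSpace X] {D : InitialDataSet (𝓡 3) X} (hD : D ∈ admissibleVacuumData X)
    (𝒟 : VacuumCauchyDevelopment D) (hmax : 𝒟.IsMaximal)
    (hscri : Summit.FinalStateConjecture.HasCompleteNullInfinity 𝒟.toCauchyDevelopment)
    (htrap : ∀ [𝒟.metric.HasLeviCivita], ∃ f : Metric.sphere (0 : E3) 1 → 𝒟.carrier,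
      range f ⊆ 𝒟.metric.causalFuture 𝒟.timeOrientation (range 𝒟.embed) ∧
        𝒟.metric.IsTrappedSurface (𝓡 2) 𝒟.timeOrientation f) :
    ∀ [𝒟.metric.HasLeviCivita], ∃ q : 𝒟.carrier, ∀ (p : X) (γ : ℝ → 𝒟.carrier) (dom : Set ℝ),
      𝒟.metric.IsNormalisedNullRayFrom 𝒟.timeOrientation 𝒟.embed 𝒟.normal p γ dom → ¬ BddAbove dom →
        q ∉ 𝒟.metric.chronologicalPast 𝒟.timeOrientation (γ '' (dom ∩ Set.Ici 0)) :=
  stub_trappedHasHorizon_of_cruxes hM hT X D hD 𝒟 hmax hscri htrap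

/-- **Black-hole form of the joint prediction**: under the two cruxes, a censored MGHD of an admissible datum with a closed
trapped surface to the causal future of the data has NONEMPTY intrinsic black-hole region `𝓑 = M ∖ I⁻(𝓘⁺)`
(`DataEmbedding.blackHoleRegion`, via `noHorizon_iff_blackHoleRegion_eq_empty`). Wald 1984, Prop. 12.2.2.
[cite: Wald1984, §12.2, Prop. 12.2.2] -/
theorem trappedSurface_blackHoleRegion_nonempty_of_cruxes (hM : HorizonlessMustDrain)
    (hT : ∀ (X : Type) [TopologicalSpace X] [ChartedSpace E3 X] [IsManifold (𝓡 3) ∞ X] [T2Space X]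
      [SecondCountableTopology X] [ConnectedSpace X],
      ∀ D ∈ admissibleVacuumData X, ∀ 𝒟 : VacuumCauchyDevelopment D, 𝒟.IsMaximal →
        Summit.FinalStateConjecture.HasCompleteNullInfinity 𝒟.toCauchyDevelopment →
        (∀ [𝒟.metric.HasLeviCivita], ∃ f : Metric.sphere (0 : E3) 1 → 𝒟.carrier,
          range f ⊆ 𝒟.metric.causalFuture 𝒟.timeOrientation (range 𝒟.embed) ∧
            𝒟.metric.IsTrappedSurface (𝓡 2) 𝒟.timeOrientation f) →
        ¬ 𝒟.toCauchyDevelopment.HasVanishingFinalBondiMass)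
    {X : Type} [TopologicalSpace X] [ChartedSpace E3 X] [IsManifold (𝓡 3) ∞ X] [T2Space X]
    [SecondCountableTopology X] [ConnectedSpace X] {D : InitialDataSet (𝓡 3) X} (hD : D ∈ admissibleVacuumData X)
    (𝒟 : VacuumCauchyDevelopment D) [𝒟.metric.HasLeviCivita] (hmax : 𝒟.IsMaximal)
    (hscri : Summit.FinalStateConjecture.HasCompleteNullInfinity 𝒟.toCauchyDevelopment)
    (htrap : ∀ [𝒟.metric.HasLeviCivita], ∃ f : Metric.sphere (0 : E3) 1 → 𝒟.carrier,
      range f ⊆ 𝒟.metric.causalFuture 𝒟.timeOrientation (range 𝒟.embed) ∧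
        𝒟.metric.IsTrappedSurface (𝓡 2) 𝒟.timeOrientation f) :
    (𝒟.toDataEmbedding.blackHoleRegion).Nonempty := by
  rw [nonempty_iff_ne_empty, Ne, ← noHorizon_iff_blackHoleRegion_eq_empty, not_not]
  exact trappedSurface_hasEventHorizon_of_cruxes hM hT hD 𝒟 hmax hscri htrap

/-- **The disprover's joint target**: a censored (complete `𝓘⁺`, sojourn form), HORIZONLESS maximal vacuum Cauchy development
of an admissible datum that contains a closed trapped surface to the causal future of the data refutes the conjunction of the
two Bondi cruxes — at least one of `HorizonlessMustDrain`, `TrappedImpliesMassive` is then false (no Bondi mass needs to be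
computed).  In real mathematics such an object contradicts Penrose's theorem (a trapped surface visible from a complete `𝓘⁺`),
which is why neither crux is threatened by it; in the tree that theorem is not yet available in the sojourn typing. [folklore] -/
theorem not_both_cruxes_of_trappedHorizonless
    {X : Type} [TopologicalSpace X] [ChartedSpace E3 X] [IsManifold (𝓡 3) ∞ X] [T2Space X]
    [SecondCountableTopology X] [ConnectedSpace X] {D : InitialDataSet (𝓡 3) X} (hD : D ∈ admissibleVacuumData X)
    (𝒟 : VacuumCauchyDevelopment D) (hmax : 𝒟.IsMaximal)
    (hscri : Summit.FinalStateConjecture.HasCompleteNullInfinity 𝒟.toCauchyDevelopment)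
    (hH : ¬ ∀ [𝒟.metric.HasLeviCivita], ∃ q : 𝒟.carrier, ∀ (p : X) (γ : ℝ → 𝒟.carrier) (dom : Set ℝ),
      𝒟.metric.IsNormalisedNullRayFrom 𝒟.timeOrientation 𝒟.embed 𝒟.normal p γ dom → ¬ BddAbove dom →
        q ∉ 𝒟.metric.chronologicalPast 𝒟.timeOrientation (γ '' (dom ∩ Set.Ici 0)))
    (htrap : ∀ [𝒟.metric.HasLeviCivita], ∃ f : Metric.sphere (0 : E3) 1 → 𝒟.carrier,
      range f ⊆ 𝒟.metric.causalFuture 𝒟.timeOrientation (range 𝒟.embed) ∧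
        𝒟.metric.IsTrappedSurface (𝓡 2) 𝒟.timeOrientation f) :
    ¬ (HorizonlessMustDrain ∧
      ∀ (X : Type) [TopologicalSpace X] [ChartedSpace E3 X] [IsManifold (𝓡 3) ∞ X] [T2Space X]
        [SecondCountableTopology X] [ConnectedSpace X],
        ∀ D ∈ admissibleVacuumData X, ∀ 𝒟 : VacuumCauchyDevelopment D, 𝒟.IsMaximal →
          Summit.FinalStateConjecture.HasCompleteNullInfinity 𝒟.toCauchyDevelopment →
          (∀ [𝒟.metric.HasLeviCivita], ∃ f : Metric.sphere (0 : E3) 1 → 𝒟.carrier,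
            range f ⊆ 𝒟.metric.causalFuture 𝒟.timeOrientation (range 𝒟.embed) ∧
              𝒟.metric.IsTrappedSurface (𝓡 2) 𝒟.timeOrientation f) →
          ¬ 𝒟.toCauchyDevelopment.HasVanishingFinalBondiMass) :=
  fun h ↦ hH (trappedSurface_hasEventHorizon_of_cruxes h.1 h.2 hD 𝒟 hmax hscri htrap)

end Summit.FinalStateConjecture.FinalStateConjecture.Theorems.BondiDrainDispersalHorizonlessMustDrain

end
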